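import Summits.Ventures.Crystal3D.Theorems.StickyWulffConstantGenericWallFloorEndBallMenuTable
import Summits.Ventures.Crystal3D.Theorems.StickyWulffConstantGenericWallFloorPayerMultiplicity
import Summits.Ventures.Crystal3D.Theorems.StickyWulffConstantGenericWallFloorRigidRung
import HarnessLib

/-!
# The PAYER-SIDE INEQUALITY of the off-menu branch: an off-menu ball near a certified end ball forces a payer
# within `2 + √3`, and `#(such end balls) ≤ 606 · #payers ≤ 1212 · D(X)`
# (crux `GenericWallFloor`, stmt-Ventures-19480, line `WallLedgerG`; cf-p1 ORDER 2026-08-28T20:38Z (2))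

HONEST FRAMING. Venture `Summits/Ventures/Crystal3D` (cell `crystal3d-full`), helper `--supports` the crux `GenericWallFloor`
of `route-Ventures-StickyWulffConstant`, REGISTERED line `WallLedgerG`, open stub `stub_twoSlabAdhesion`.  Rung credit only;
F-C1 not moved; NOT the crux.  Census-free, standard axioms; GAP/CLASSIFICATION (`δ ≥ 5/2`) are hypotheses as upstream.

This is item (2) of cf-p1's order («the payer-side bound the off-menu branch cites, as one named inequality per end ball»),
in the honest constants of the dichotomy (payer within `2` of the off-menu ball, within `2 + √3` of the end ball; multiplicity
`≤ 606` end balls per payer, `…PayerMultiplicity`):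
* §1 **`payer_of_offMenu`** (PER END BALL, table form): GAP/CLASS, `X` `1`-separated, `z ∈ X` with certified slot contacts
  `z + A (slotSite i)` (`i ∈ S`) and `deg z ≤ |S| + 1`; if some `x ∈ X`, `x ≠ z`, `dist x z ≤ √3` is OFF THE MENU
  (`x ≠ z + A·pointVec q` for every `q ∈ menuQ3` — a finite check), then some `y ∈ X`, `y ≠ z`, `dist z y ≤ 2 + √3`, has at most
  eleven contacts.  (`payer_of_offMenu_abstract`: the same with the abstract dozens of `…EndBallUniverse`.)
* §2 **THE LEDGER INEQUALITY**: `card_le_mul_card_of_near` (pigeonhole with multiplicity), **`card_le_mul_card_payers`**: for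
  `Z ⊆ X` such that every `z ∈ Z` has a payer within `2 + √3`, `|Z| ≤ 606 · #{y ∈ X : deg y ≤ 11}`;
  `card_unsaturated_le_two_mul_contactDeficiency`: `#{y ∈ X : deg y ≤ 11} ≤ 2·D(X) = Σ_y (12 − deg y)`; hence
  **`card_le_contactDeficiency_of_payers`**: `|Z| ≤ 1212 · D(X)` — the constant-factor device of memo STRUCTURAL-GLUE-g10 §3(2)
  in kernel form (the sharp `c₀ = 1` use remains class-by-class).
WHAT THIS IS NOT: no class enumeration; the constants are crude volume bounds; F-C1 not moved.
-/

noncomputable section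

namespace Summit.Ventures.Crystal3D.Theorems

open Summit.Ventures.Crystal3D Finset NearIdentity
open Literature.MathematicalPhysics.StatisticalMechanics (contactDeficiency)
open scoped InnerProductSpace

variable {X : Finset (EuclideanSpace ℝ (Fin 3))}

/-! ### §1 Per end ball: an off-menu neighbour forces a payer within `2 + √3` -/

/-- **Off-menu ⇒ payer (table form).**  GAP(`δ`) ∧ CLASSIFICATION(`δ`), `δ ≥ 5/2`; `X` `1`-separated; `z ∈ X` with certified
slot contacts `z + A (slotSite i)`, `i ∈ S`, and at most `|S| + 1` contacts; `x ∈ X`, `x ≠ z`, `dist x z ≤ √3` with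
`x ≠ z + A (pointVec q)` for all `q ∈ menuQ3`.  Then some `y ∈ X`, `y ≠ z`, `dist z y ≤ 2 + √3`, has at most eleven contacts. -/
theorem payer_of_offMenu {δ : ℝ} (hg : KissingGap δ) (hc : KissingClassification δ) (hδ : 5 / 2 ≤ δ)
    (hX : ∀ p ∈ X, ∀ q ∈ X, p ≠ q → 1 ≤ dist p q)
    (A : EuclideanSpace ℝ (Fin 3) ≃ₗᵢ[ℝ] EuclideanSpace ℝ (Fin 3)) {z : EuclideanSpace ℝ (Fin 3)} (hz : z ∈ X)
    (S : Finset (Fin 12)) (hSX : ∀ i ∈ S, z + A (slotSite i) ∈ X)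
    (hdeg : (X.filter fun q => dist z q = 1).card ≤ S.card + 1)
    {x : EuclideanSpace ℝ (Fin 3)} (hx : x ∈ X) (hxz : x ≠ z) (h3 : dist x z ≤ Real.sqrt 3)
    (hoff : ∀ q ∈ menuQ3, x ≠ z + A (pointVec q)) :
    ∃ y ∈ X, y ≠ z ∧ dist z y ≤ 2 + Real.sqrt 3 ∧ (X.filter fun q => dist y q = 1).card ≤ 11 := by
  rcases mem_menuQ3_or_payer_of_near_endBall hg hc hδ hX A hz S hSX hdeg hx hxz h3 with ⟨y, hy, hyz, hxy, hy11⟩ | ⟨q, hq, h⟩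
  · refine ⟨y, hy, hyz, ?_, hy11⟩
    calc dist z y ≤ dist z x + dist x y := dist_triangle _ _ _
      _ ≤ Real.sqrt 3 + 2 := add_le_add (by rw [dist_comm]; exact h3) hxy
      _ = 2 + Real.sqrt 3 := add_comm _ _
  · exact absurd h (hoff q hq)

/-- **Off-menu ⇒ payer (abstract form).**  As `payer_of_offMenu`, with certified slots `S ⊆ fccSlots` and «off the menu» meaning:
`x` is in no exact dozen configuration `(z − v′) [+ v]` of the grain as in `menu_or_payer_of_near_endBall`. -/
theorem payer_of_offMenu_abstract {δ : ℝ} (hg : KissingGap δ) (hc : KissingClassification δ) (hδ : 5 / 2 ≤ δ)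
    (hX : ∀ p ∈ X, ∀ q ∈ X, p ≠ q → 1 ≤ dist p q)
    (A : EuclideanSpace ℝ (Fin 3) ≃ₗᵢ[ℝ] EuclideanSpace ℝ (Fin 3)) {z : EuclideanSpace ℝ (Fin 3)} (hz : z ∈ X)
    (S : Finset (EuclideanSpace ℝ (Fin 3))) (hS : ∀ w ∈ S, w ∈ fccSlots) (hSX : ∀ w ∈ S, z + A w ∈ X)
    (hdeg : (X.filter fun q => dist z q = 1).card ≤ S.card + 1)
    {x : EuclideanSpace ℝ (Fin 3)} (hx : x ∈ X) (hxz : x ≠ z) (h3 : dist x z ≤ Real.sqrt 3)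
    (hoff : ∀ (D : Set (EuclideanSpace ℝ (Fin 3))) (v' : EuclideanSpace ℝ (Fin 3)),
      (D = A '' (↑fccSlots : Set (EuclideanSpace ℝ (Fin 3))) ∨
        ∃ n : EuclideanSpace ℝ (Fin 3), ‖n‖ = 1 ∧
          (∀ w ∈ fccSlots, ⟪A w, n⟫_ℝ = 0 ∨ ⟪A w, n⟫_ℝ = Real.sqrt (2 / 3) ∨ ⟪A w, n⟫_ℝ = -Real.sqrt (2 / 3)) ∧
          D = (fun w => A w) '' {w | w ∈ fccSlots ∧ ⟪A w, n⟫_ℝ ≤ 0} ∪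
            (fun w => A w - (2 * ⟪A w, n⟫_ℝ) • n) '' {w | w ∈ fccSlots ∧ ⟪A w, n⟫_ℝ < 0}) →
      v' ∈ D → z - v' ∈ X → ¬ (x = z - v' ∨ ∃ v ∈ D, x = z - v' + v)) :
    ∃ y ∈ X, y ≠ z ∧ dist z y ≤ 2 + Real.sqrt 3 ∧ (X.filter fun q => dist y q = 1).card ≤ 11 := by
  rcases menu_or_payer_of_near_endBall hg hc hδ hX A hz S hS hSX hdeg hx hxz h3 with
    ⟨y, hy, hyz, hxy, hy11⟩ | ⟨D, v', hD, hv', hzv', -, -, -, -, hxcase⟩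
  · refine ⟨y, hy, hyz, ?_, hy11⟩
    calc dist z y ≤ dist z x + dist x y := dist_triangle _ _ _
      _ ≤ Real.sqrt 3 + 2 := add_le_add (by rw [dist_comm]; exact h3) hxy
      _ = 2 + Real.sqrt 3 := add_comm _ _
  · exact absurd hxcase (hoff D v' hD hv' hzv')

/-! ### §2 The ledger inequality: end balls needing a payer are at most `606 ×` the payers -/

/-- **Pigeonhole with multiplicity.**  If every `z ∈ Z` has some `y ∈ Y` within `R`, and every `y ∈ Y` has at most `M` points of
`X ⊇ Z` within `R`, then `|Z| ≤ M · |Y|`. -/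
theorem card_le_mul_card_of_near {Z Y : Finset (EuclideanSpace ℝ (Fin 3))} (hZ : Z ⊆ X) {R : ℝ} {M : ℕ}
    (hM : ∀ y ∈ Y, (X.filter fun x => dist y x ≤ R).card ≤ M) (hnear : ∀ z ∈ Z, ∃ y ∈ Y, dist y z ≤ R) :
    Z.card ≤ M * Y.card := by
  classical
  have hsub : Z ⊆ Y.biUnion fun y => X.filter fun x => dist y x ≤ R := by
    intro z hz
    obtain ⟨y, hy, hyz⟩ := hnear z hz
    exact Finset.mem_biUnion.2 ⟨y, hy, Finset.mem_filter.2 ⟨hZ hz, hyz⟩⟩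
  calc Z.card ≤ (Y.biUnion fun y => X.filter fun x => dist y x ≤ R).card := Finset.card_le_card hsub
    _ ≤ ∑ y ∈ Y, (X.filter fun x => dist y x ≤ R).card := Finset.card_biUnion_le
    _ ≤ ∑ _y ∈ Y, M := Finset.sum_le_sum hM
    _ = M * Y.card := by rw [Finset.sum_const, smul_eq_mul, mul_comm]

/-- **THE PAYER-SIDE INEQUALITY.**  `X` `1`-separated, `Z ⊆ X`, and every `z ∈ Z` has a payer `y ∈ X` with `dist z y ≤ 2 + √3`
and at most eleven contacts.  Then `|Z| ≤ 606 · #{y ∈ X : deg y ≤ 11}`. -/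
theorem card_le_mul_card_payers (hX : ∀ p ∈ X, ∀ q ∈ X, p ≠ q → 1 ≤ dist p q)
    {Z : Finset (EuclideanSpace ℝ (Fin 3))} (hZ : Z ⊆ X)
    (hpay : ∀ z ∈ Z, ∃ y ∈ X, dist z y ≤ 2 + Real.sqrt 3 ∧ (X.filter fun q => dist y q = 1).card ≤ 11) :
    Z.card ≤ 606 * (X.filter fun y => (X.filter fun q => dist y q = 1).card ≤ 11).card := by
  refine card_le_mul_card_of_near hZ (R := 2 + Real.sqrt 3)
    (fun y _ => card_filter_dist_le_two_add_sqrt_three_le_606 hX y) fun z hz => ?_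
  obtain ⟨y, hy, hzy, hy11⟩ := hpay z hz
  exact ⟨y, Finset.mem_filter.2 ⟨hy, hy11⟩, by rw [dist_comm]; exact hzy⟩

/-- **Unsaturated balls are paid for by the deficiency:** `#{y ∈ X : deg y ≤ 11} ≤ 2·D(X) = Σ_{y ∈ X} (12 − deg y)`. -/
theorem card_unsaturated_le_two_mul_contactDeficiency (hX : ∀ p ∈ X, ∀ q ∈ X, p ≠ q → 1 ≤ dist p q) :
    ((X.filter fun y => (X.filter fun q => dist y q = 1).card ≤ 11).card : ℝ) ≤ 2 * contactDeficiency X := by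
  classical
  rw [two_mul_contactDeficiency_eq_sum, Finset.card_filter, Nat.cast_sum]
  refine Finset.sum_le_sum fun y hy => ?_
  have h12 := card_filter_dist_eq_one_le_twelve X hX y
  split_ifs with h
  · have : ((X.filter fun q => dist y q = 1).card : ℝ) ≤ 11 := by exact_mod_cast h
    push_cast; linarith
  · have : ((X.filter fun q => dist y q = 1).card : ℝ) ≤ 12 := by exact_mod_cast h12
    push_cast; linarith

/-- **Deficiency form of the payer-side inequality:** under the hypotheses of `card_le_mul_card_payers`, `|Z| ≤ 1212 · D(X)`. -/
theorem card_le_contactDeficiency_of_payers (hX : ∀ p ∈ X, ∀ q ∈ X, p ≠ q → 1 ≤ dist p q)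
    {Z : Finset (EuclideanSpace ℝ (Fin 3))} (hZ : Z ⊆ X)
    (hpay : ∀ z ∈ Z, ∃ y ∈ X, dist z y ≤ 2 + Real.sqrt 3 ∧ (X.filter fun q => dist y q = 1).card ≤ 11) :
    (Z.card : ℝ) ≤ 1212 * contactDeficiency X := by
  have h1 : (Z.card : ℝ) ≤ 606 * ((X.filter fun y => (X.filter fun q => dist y q = 1).card ≤ 11).card : ℝ) := by
    exact_mod_cast card_le_mul_card_payers hX hZ hpay
  have h2 := card_unsaturated_le_two_mul_contactDeficiency hX
  linarith

/-- **End balls with an off-menu neighbour, counted.**  GAP/CLASS (`δ ≥ 5/2`), `X` `1`-separated, `Z ⊆ X` a set of certified end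
balls — each `z ∈ Z` with a frame `A`, slot indices `S` (`z + A (slotSite i) ∈ X`, `deg z ≤ |S| + 1`) and an OFF-MENU ball
`x ∈ X`, `x ≠ z`, `dist x z ≤ √3`, `x ∉ z + A·pointVec (menuQ3)`.  Then `|Z| ≤ 606 · #{y ∈ X : deg y ≤ 11} ≤ 1212 · D(X)`. -/
theorem card_offMenu_endBalls_le {δ : ℝ} (hg : KissingGap δ) (hc : KissingClassification δ) (hδ : 5 / 2 ≤ δ)
    (hX : ∀ p ∈ X, ∀ q ∈ X, p ≠ q → 1 ≤ dist p q) {Z : Finset (EuclideanSpace ℝ (Fin 3))} (hZ : Z ⊆ X)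
    (hoff : ∀ z ∈ Z, ∃ (A : EuclideanSpace ℝ (Fin 3) ≃ₗᵢ[ℝ] EuclideanSpace ℝ (Fin 3)) (S : Finset (Fin 12)),
      (∀ i ∈ S, z + A (slotSite i) ∈ X) ∧ (X.filter fun q => dist z q = 1).card ≤ S.card + 1 ∧
      ∃ x ∈ X, x ≠ z ∧ dist x z ≤ Real.sqrt 3 ∧ ∀ q ∈ menuQ3, x ≠ z + A (pointVec q)) :
    Z.card ≤ 606 * (X.filter fun y => (X.filter fun q => dist y q = 1).card ≤ 11).card ∧
      (Z.card : ℝ) ≤ 1212 * contactDeficiency X := by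
  have hpay : ∀ z ∈ Z, ∃ y ∈ X, dist z y ≤ 2 + Real.sqrt 3 ∧ (X.filter fun q => dist y q = 1).card ≤ 11 := by
    intro z hzZ
    obtain ⟨A, S, hSX, hdeg, x, hx, hxz, h3, hxoff⟩ := hoff z hzZ
    obtain ⟨y, hy, -, hzy, hy11⟩ := payer_of_offMenu hg hc hδ hX A (hZ hzZ) S hSX hdeg hx hxz h3 hxoff
    exact ⟨y, hy, hzy, hy11⟩
  exact ⟨card_le_mul_card_payers hX hZ hpay, card_le_contactDeficiency_of_payers hX hZ hpay⟩

end Summit.Ventures.Crystal3D.Theorems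

end
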